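import Summits.QuantumFields.YangMills.Theorems.BalabanUVNodesPortS1FibreGraphPoint
import Summits.QuantumFields.YangMills.Theorems.BalabanUVNodesPortS1Chi29Reparam
import Summits.QuantumFields.YangMills.Theorems.BalabanUVNodesN09CentralWindowAtRecord

/-!
# Port S1, (T1) brick (B-e)₁ — COORDINATES OF THE TRANSLATED GRAPH POINT: off `b₀` it is the SCALED remaining variable `g·B_rem` (the (L1)↔DEF-1 change of the integration variable is a
# LINEAR SCALING — `CHART-LAW-PROOF-PLAN-v1.md` §0 key fact), on `b₀(c)` it is the solved coordinate; and the (L3-e) glue in N09-w6's currency: a LEFT INVERSE `ϑ_c` of the one-bond (0.4) map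
# returns, at a configuration already ON THE FIBRE, its own central bond value ([I] p.267–268 «B′ = B − hD̃(B)», «Denoting the remaining variables by B»)

Cell `ym-nodeO-ideate`, porter seat PT-A-1 (gen 10); `--kind proof --supports stmt-QuantumFields-27930 --as helper`; count-neutral.  [I] = [Balaban1987RG1].
Over ✓`…PortS1FibreGraphPoint` (p829655: the point is on the fibre), hand-FE-1's ✓`…PortS1Chi29Reparam` (`recordReparamOf_apply_of_not_isB0`), DEF-1's ✓`recordCopFluct`, and dag-n09-w6's
✓`…N09CentralWindowAtRecord` (the per-bond chart bundle, whose clause :158 «`ϑ c U (Ū(U[b₀(c) ↦ g])(c)) = g` on the window» is the uniqueness used here AS A HYPOTHESIS SHAPE on an abstract `ϑ`).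

WHAT IS PROVED:
* §1 `recordCopFluct_mulVec_apply_of_not_mem` (`(C·y)_i = y_i` off `b₀`), `recordCopFluct_mulVec_apply_b0` (`(C·y)_{(b₀c,j)} = −(X·y)_{(c,j)}`), ★ `recordReparamOf_recordCopFluct_apply_of_not_mem` — for ANY socket `Dt`:
  `Y_g(C·y)_i = g·y_i` off `b₀` (the integration variable of (L1)'s fibre integral, read in DEF-1's variables, is `g·B_rem`: a linear scaling).
* §2 ★★ `theta_apply_avg_eq_centralBond_of_leftInverse` — for any `ϑ` that is a left inverse of `g ↦ Ū(U[b₀(c) ↦ g])(c)` on the central `α`-window of `U` (N09-w6 :158's shape) and any `U` whose own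
  central value is in the window: `ϑ c U (Ū(U)(c)) = U(b₀ c)`; hence ★★ `theta_apply_eq_pert_recordReparamOf_b0` — at `U := pert Vk Y_g(C·y)` (ON THE FIBRE by ✓`avg_pert_recordReparamOf_recordCopFluct_eq`):
  `ϑ c U (Ū(Vk)(c)) = (pert Vk Y_g(C·y))(b₀ c)` — (L1)'s abstract solved bond value IS print's explicit one, GIVEN the window membership of that value (displayed hypothesis; its discharge from
  `‖Y_g‖ < 2ρ₀` is the (2.9)-window arithmetic of hand-FE-1's ✓`…Chi29Window`, next).

HONEST FRAMING.  Coordinates∕uniqueness bookkeeping; the measure-side rows (P-γ), (L3-d′), the assembly (B-★) and (T2) are NOT here; nothing of Bałaban's renormalization-group estimates asserted, ported or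
discharged; `FEChartLawStep`∕`FEStepBox`∕`P0FamilySupply` inhabited nowhere; `stub_P0C`∕`stub_FEstep` OPEN; ⟨27930⟩ OPEN 1∕3; NODE O 0∕1; COUNT 8∕28 · K 1∕4 UNMOVED; finite `𝕋⁴_{L^K}` at fixed ε — NOT
continuum ∕ OS; **the Yang–Mills mass gap (Clay) is NOT proved by any of this.**  No `sorry`, no `def`, no `instance`; standard axioms only.
-/

noncomputable section

open scoped BigOperators Matrix.Norms.L2Operator Topology

open Set Metric Filter Function

namespace Summit.QuantumFields.YangMills.Theorems.BalabanUVNodesPortS1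

open Summit.QuantumFields.YangMills.Theorems.K0RecordFormatNames
open Literature.MathematicalPhysics.QuantumFieldTheory.Balaban1983to89
open Literature.MathematicalPhysics.QuantumFieldTheory.Balaban1983to89.Node00
open Literature.MathematicalPhysics.QuantumFieldTheory.Balaban1983to89.T4Continuum (T4Family)
open Literature.MathematicalPhysics.QuantumFieldTheory.Balaban1983to89.BlockAveraging (avgFun loopHol Small Idx)
open Literature.MathematicalPhysics.QuantumFieldTheory.Balaban1983to89.BlockAveragingHaarAC (centralBond pre post)
open Literature.MathematicalPhysics.QuantumFieldTheory.Balaban1983to89.BlockAveragingEMLHaarAC (fibreFamily)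
open Literature.MathematicalPhysics.QuantumFieldTheory.Balaban1983to89.ExpMeanLog (expMeanLogSU)
open _root_.Matrix

variable (F : T4Family)

/-! ## §1  Coordinates of `C·y` and of `Y_g(C·y)` -/

/-- **`(C·y)_i = y_i` at a non-`b₀` coordinate** (the lower block of `C = [−X; 1]`). [cite: Balaban1987RG1, p.268 («Denoting the remaining variables by B»)] -/
theorem recordCopFluct_mulVec_apply_of_not_mem (k K : ℕ) (Vk : GaugeField (F.P K) k (SU 2)) (y : NonB0Idx F k K → ℝ) (i : NonB0Idx F k K) :
    (recordCopFluct F k K Vk *ᵥ y) i.1 = y i := by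
  classical
  rw [Matrix.mulVec, dotProduct, Finset.sum_eq_single i]
  · rw [recordCopFluct_apply_of_not_mem, if_pos rfl, one_mul]
  · intro j _ hji
    rw [recordCopFluct_apply_of_not_mem, if_neg (Ne.symm hji), zero_mul]
  · intro h; exact absurd (Finset.mem_univ i) h

/-- **`(C·y)_{(b₀c, j)} = −(X·y)_{(c,j)}`** (the upper block of `C = [−X; 1]`, `X = A₁⁻¹A₂`). [cite: Balaban1987RG1, p.268 («B′ = CB»)] -/
theorem recordCopFluct_mulVec_apply_b0 (k K : ℕ) (hk : k + 1 ≤ (F.P K).m + (F.P K).K) (Vk : GaugeField (F.P K) k (SU 2)) (y : NonB0Idx F k K → ℝ) (cj : CoarseIdx F k K) :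
    (recordCopFluct F k K Vk *ᵥ y) (recordB0 F k K cj.1, cj.2) = -((recordXLoc F k K Vk *ᵥ y) cj) := by
  rw [Matrix.mulVec, Matrix.mulVec, dotProduct, dotProduct, ← Finset.sum_neg_distrib]
  refine Finset.sum_congr rfl fun j _ => ?_
  rw [recordCopFluct_apply_b0 F k K hk Vk cj j, neg_mul]

/-- ★ **OFF `b₀` THE TRANSLATED GRAPH POINT IS THE SCALED REMAINING VARIABLE**: `Y_g(C·y)_i = g·y_i` for every non-`b₀` coordinate `i`, for ANY socket `Dt` (`h` is supported on the `b₀`-rows,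
hand-FE-1's ✓`recordReparamOf_apply_of_not_isB0`) — the change between (L1)'s integration variable and DEF-1's `B_rem` is the LINEAR SCALING by `g`. [cite: Balaban1987RG1, p.267–268] -/
theorem recordReparamOf_recordCopFluct_apply_of_not_mem (k : ℕ) {K : ℕ} (Dt : GaugeField (F.P K) k (SU 2) → (FluctIdx F k K → ℂ) → (PBond (F.P K) (k + 1) → MatA 2))
    (Vk : GaugeField (F.P K) k (SU 2)) (g : ℝ) (y : NonB0Idx F k K → ℝ) (i : NonB0Idx F k K) :
    recordReparamOf F k Dt Vk g (recordCopFluct F k K Vk *ᵥ y) i.1 = g * y i := by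
  have hb : ¬ IsB0 (F := F) i.1.1 := fun ⟨c, hc⟩ => i.2 ⟨c, hc⟩
  have h := recordReparamOf_apply_of_not_isB0 F k Dt Vk g (recordCopFluct F k K Vk *ᵥ y) hb i.1.2
  rw [Prod.mk.eta] at h
  rw [h, recordCopFluct_mulVec_apply_of_not_mem]

/-! ## §2  (L3-e) in N09-w6's currency: a left inverse of the one-bond map returns the central value of a point on the fibre -/

variable {F} in
/-- ★★ **A LEFT INVERSE `ϑ_c` OF `g ↦ Ū(U[b₀(c) ↦ g])(c)` ON THE CENTRAL `α`-WINDOW RETURNS `U(b₀ c)` AT `Ū(U)(c)`** whenever `U(b₀ c)` itself is in the window (`U[b₀(c) ↦ U(b₀ c)] = U`) — the shape of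
dag-n09-w6's ✓`exists_perBondCharts_of_forwardLaws` clause «`ϑ c U (Ū(update U (centralBond c) g)(c)) = g`». [cite: Balaban1987RG1, p.267 (the central bond variable solved by the constraint)] -/
theorem theta_apply_avg_eq_centralBond_of_leftInverse {K k : ℕ} {α : ℝ} {ϑ : PBond (F.P K) (k + 1) → GaugeField (F.P K) k (SU 2) → SU 2 → SU 2}
    (c : PBond (F.P K) (k + 1)) (U : GaugeField (F.P K) k (SU 2))
    (hϑ : ∀ g : SU 2, (∀ i : Idx (F.P K), dist1 (fibreFamily U c (pre U c * g * post U c) i) ≤ α) →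
      ϑ c U ((avOfRecord F 2 K k).avg (update U (centralBond c) g) c) = g)
    (hwin : ∀ i : Idx (F.P K), dist1 (fibreFamily U c (pre U c * U (centralBond c) * post U c) i) ≤ α) :
    ϑ c U ((avOfRecord F 2 K k).avg U c) = U (centralBond c) := by
  have h := hϑ (U (centralBond c)) hwin
  rwa [update_eq_self] at h

variable {F} in
/-- ★★ **(L3-e) AT THE TRANSLATED GRAPH POINT**: with `U := pert Vk Y_g(C·y)` (ON THE FIBRE over `Ū(Vk)` by ✓`avg_pert_recordReparamOf_recordCopFluct_eq`, `‖↑(g·C·y)‖ < ρ₀(d,L,α)`), any left inverse `ϑ_c`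
of the one-bond map on `U`'s central window gives `ϑ c U (Ū(Vk)(c)) = (pert Vk Y_g(C·y))(b₀ c)` — (L1)'s abstract solved central value IS print's explicit one, GIVEN that this value lies in the
window (displayed). [cite: Balaban1987RG1, p.267–268] -/
theorem theta_apply_eq_pert_recordReparamOf_b0 {k K : ℕ} (hk : k + 1 ≤ (F.P K).m + (F.P K).K) (Vk : GaugeField (F.P K) k (SU 2)) {α : ℝ}
    (hα : ∀ (c : PBond (F.P K) (k + 1)) (i : Idx (F.P K)), dist1 (loopHol Vk c i) ≤ α) (hαL : 157 * α < (((F.P K).L : ℝ) ^ ((F.P K).d - 1))⁻¹)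
    (g : ℝ) (y : NonB0Idx F k K → ℝ)
    (hgy : ‖(fun i => ((g • (recordCopFluct F k K Vk *ᵥ y)) i : ℂ))‖ < (min ((1 : ℝ) / (10 ^ 8 * (F.P K).d * (F.P K).L) / 3) (1 / (18 * (2 * 1 / (1 / (10 ^ 8 * (F.P K).d * (F.P K).L)) ^ 2) * ((6 / ((((F.P K).L : ℝ) ^ ((F.P K).d - 1))⁻¹ - 157 * α)) + 1)))))
    {α' : ℝ} {ϑ : PBond (F.P K) (k + 1) → GaugeField (F.P K) k (SU 2) → SU 2 → SU 2} (c : PBond (F.P K) (k + 1))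
    (hϑ : ∀ g' : SU 2, (∀ i : Idx (F.P K), dist1 (fibreFamily
        (pert F k K Vk (recordReparamOf F k (fun Vk => recordDt F k K Vk (min ((1 : ℝ) / (10 ^ 8 * (F.P K).d * (F.P K).L) / 3) (1 / (18 * (2 * 1 / (1 / (10 ^ 8 * (F.P K).d * (F.P K).L)) ^ 2) * ((6 / ((((F.P K).L : ℝ) ^ ((F.P K).d - 1))⁻¹ - 157 * α)) + 1))))) Vk g (recordCopFluct F k K Vk *ᵥ y))) c
        (pre (pert F k K Vk (recordReparamOf F k (fun Vk => recordDt F k K Vk (min ((1 : ℝ) / (10 ^ 8 * (F.P K).d * (F.P K).L) / 3) (1 / (18 * (2 * 1 / (1 / (10 ^ 8 * (F.P K).d * (F.P K).L)) ^ 2) * ((6 / ((((F.P K).L : ℝ) ^ ((F.P K).d - 1))⁻¹ - 157 * α)) + 1))))) Vk g (recordCopFluct F k K Vk *ᵥ y))) c * g' *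
         post (pert F k K Vk (recordReparamOf F k (fun Vk => recordDt F k K Vk (min ((1 : ℝ) / (10 ^ 8 * (F.P K).d * (F.P K).L) / 3) (1 / (18 * (2 * 1 / (1 / (10 ^ 8 * (F.P K).d * (F.P K).L)) ^ 2) * ((6 / ((((F.P K).L : ℝ) ^ ((F.P K).d - 1))⁻¹ - 157 * α)) + 1))))) Vk g (recordCopFluct F k K Vk *ᵥ y))) c) i) ≤ α') →
      ϑ c (pert F k K Vk (recordReparamOf F k (fun Vk => recordDt F k K Vk (min ((1 : ℝ) / (10 ^ 8 * (F.P K).d * (F.P K).L) / 3) (1 / (18 * (2 * 1 / (1 / (10 ^ 8 * (F.P K).d * (F.P K).L)) ^ 2) * ((6 / ((((F.P K).L : ℝ) ^ ((F.P K).d - 1))⁻¹ - 157 * α)) + 1))))) Vk g (recordCopFluct F k K Vk *ᵥ y)))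
        ((avOfRecord F 2 K k).avg (update (pert F k K Vk (recordReparamOf F k (fun Vk => recordDt F k K Vk (min ((1 : ℝ) / (10 ^ 8 * (F.P K).d * (F.P K).L) / 3) (1 / (18 * (2 * 1 / (1 / (10 ^ 8 * (F.P K).d * (F.P K).L)) ^ 2) * ((6 / ((((F.P K).L : ℝ) ^ ((F.P K).d - 1))⁻¹ - 157 * α)) + 1))))) Vk g (recordCopFluct F k K Vk *ᵥ y))) (centralBond c) g') c) = g')
    (hwin : ∀ i : Idx (F.P K), dist1 (fibreFamily
        (pert F k K Vk (recordReparamOf F k (fun Vk => recordDt F k K Vk (min ((1 : ℝ) / (10 ^ 8 * (F.P K).d * (F.P K).L) / 3) (1 / (18 * (2 * 1 / (1 / (10 ^ 8 * (F.P K).d * (F.P K).L)) ^ 2) * ((6 / ((((F.P K).L : ℝ) ^ ((F.P K).d - 1))⁻¹ - 157 * α)) + 1))))) Vk g (recordCopFluct F k K Vk *ᵥ y))) c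
        (pre (pert F k K Vk (recordReparamOf F k (fun Vk => recordDt F k K Vk (min ((1 : ℝ) / (10 ^ 8 * (F.P K).d * (F.P K).L) / 3) (1 / (18 * (2 * 1 / (1 / (10 ^ 8 * (F.P K).d * (F.P K).L)) ^ 2) * ((6 / ((((F.P K).L : ℝ) ^ ((F.P K).d - 1))⁻¹ - 157 * α)) + 1))))) Vk g (recordCopFluct F k K Vk *ᵥ y))) c *
          pert F k K Vk (recordReparamOf F k (fun Vk => recordDt F k K Vk (min ((1 : ℝ) / (10 ^ 8 * (F.P K).d * (F.P K).L) / 3) (1 / (18 * (2 * 1 / (1 / (10 ^ 8 * (F.P K).d * (F.P K).L)) ^ 2) * ((6 / ((((F.P K).L : ℝ) ^ ((F.P K).d - 1))⁻¹ - 157 * α)) + 1))))) Vk g (recordCopFluct F k K Vk *ᵥ y)) (centralBond c) *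
         post (pert F k K Vk (recordReparamOf F k (fun Vk => recordDt F k K Vk (min ((1 : ℝ) / (10 ^ 8 * (F.P K).d * (F.P K).L) / 3) (1 / (18 * (2 * 1 / (1 / (10 ^ 8 * (F.P K).d * (F.P K).L)) ^ 2) * ((6 / ((((F.P K).L : ℝ) ^ ((F.P K).d - 1))⁻¹ - 157 * α)) + 1))))) Vk g (recordCopFluct F k K Vk *ᵥ y))) c) i) ≤ α') :
    ϑ c (pert F k K Vk (recordReparamOf F k (fun Vk => recordDt F k K Vk (min ((1 : ℝ) / (10 ^ 8 * (F.P K).d * (F.P K).L) / 3) (1 / (18 * (2 * 1 / (1 / (10 ^ 8 * (F.P K).d * (F.P K).L)) ^ 2) * ((6 / ((((F.P K).L : ℝ) ^ ((F.P K).d - 1))⁻¹ - 157 * α)) + 1))))) Vk g (recordCopFluct F k K Vk *ᵥ y)))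
        ((avOfRecord F 2 K k).avg Vk c) =
      pert F k K Vk (recordReparamOf F k (fun Vk => recordDt F k K Vk (min ((1 : ℝ) / (10 ^ 8 * (F.P K).d * (F.P K).L) / 3) (1 / (18 * (2 * 1 / (1 / (10 ^ 8 * (F.P K).d * (F.P K).L)) ^ 2) * ((6 / ((((F.P K).L : ℝ) ^ ((F.P K).d - 1))⁻¹ - 157 * α)) + 1))))) Vk g (recordCopFluct F k K Vk *ᵥ y)) (centralBond c) := by
  rw [← avg_pert_recordReparamOf_recordCopFluct_eq hk Vk hα hαL g y hgy c]
  exact theta_apply_avg_eq_centralBond_of_leftInverse c _ hϑ hwin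

end Summit.QuantumFields.YangMills.Theorems.BalabanUVNodesPortS1

end
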